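import Summits.Ventures.Crystal3D.Theorems.StickyWulffConstantGenericWallFloorVacancyCage
import Summits.Ventures.Crystal3D.Theorems.StickyWulffConstantGenericWallFloorStarLemma
import HarnessLib

/-!
# The vacancy cage, row version: a hole whose cage misses only an ANTIPODAL PAIR of sites is still addable
# (crux `GenericWallFloor`, stmt-Ventures-19480, line `WallLedgerG`; memo RISER-LEDGER-g8 §8, HOME/wall-p1-g8/)

HONEST FRAMING. Venture `Summits/Ventures/Crystal3D` (cell `crystal3d-full`), helper `--supports` the crux
`GenericWallFloor` of `route-Ventures-StickyWulffConstant`, REGISTERED line `WallLedgerG`, open stub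
`stub_twoSlabAdhesion`.  Structure only (census-free); F-C1 not moved; NOT the crux, no ledger here.

Memo §8: the cheapest attacks on walker menus remove whole lattice ROWS; a vacancy inside a vacated row has its cage complete
except for the two row neighbours `v ± A r` — so `one_le_dist_of_cage` (`…VacancyCage`, complete cage) prices nothing there,
while THIS lemma prices the row attacks found by kit j312851 (3.25 → 8.5 and 16.5 certified balls/ul ≫ 4.243):

* `exists_perp_slot` — every slot `r` has an orthogonal slot `r⊥` (table, cubic coordinates);
* (private) Bessel for two orthonormal vectors (a public copy lives in `…Steering`, not imported here);
* `exists_slot_inner_ge_half_avoiding` — for every slot `r` and every `x` some slot `w ∉ {r, −r}` has `‖x‖² ≤ 4⟪A w, x⟫²`,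
  `⟪A w, x⟫ ≥ 0`: the eight slots off `±r, ±r⊥` carry `Σ ⟪A w, x⟫² = 4‖x‖² − 2⟪A r, x⟫² − 2⟪A r⊥, x⟫² ≥ 2‖x‖²` (tight frame
  + Bessel), pigeonhole (`exists_slot_inner_sq_ge_of_sum`);
* **`one_le_dist_of_cage_sub_pair`** — unit packing `X`, `v ∉ X`, cage sites `v + A w ∈ X` for all slots `w ≠ ±r` ⇒ every
  ball of `X` is at distance `≥ 1` from `v` (`⟪A w, x − v⟫ ≥ ‖x − v‖/2 > ‖x − v‖²/2`: overlap with the cage ball `v + A w`);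
* **`card_contacts_le_eleven_of_cage_sub_pair`** — hence every ball touching such a hole has `≤ 11` contacts.
WHAT THIS IS NOT: no ledger; cages missing two NON-antipodal or more sites are not treated; F-C1 not moved.
-/

noncomputable section

namespace Summit.Ventures.Crystal3D.Theorems

open Finset NearIdentity
open scoped InnerProductSpace

variable {X : Finset (EuclideanSpace ℝ (Fin 3))}

/-- Index of a slot orthogonal to slot `k` (cubic coordinates `slotInt`). -/
def perpIdx : Fin 12 → Fin 12 := ![1, 0, 0, 1, 5, 4, 4, 5, 9, 8, 8, 9]

/-- Table check: `slotInt k ⬝ᵥ slotInt (perpIdx k) = 0`. -/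
theorem slotInt_dot_perpIdx : ∀ k : Fin 12, slotInt k ⬝ᵥ slotInt (perpIdx k) = 0 := by decide

/-- **Every slot has an orthogonal slot.** -/
theorem exists_perp_slot {r : EuclideanSpace ℝ (Fin 3)} (hr : r ∈ fccSlots) : ∃ r' ∈ fccSlots, ⟪r, r'⟫_ℝ = 0 := by
  obtain ⟨k, rfl⟩ := exists_slotSite_eq hr
  refine ⟨slotSite (perpIdx k), slotSite_mem _, ?_⟩
  rw [inner_slotSite, slotInt_dot_perpIdx]; simp

/-- Bessel for two orthonormal vectors: `⟪u₁, x⟫² + ⟪u₂, x⟫² ≤ ‖x‖²`. -/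
private theorem bessel_two_local (u₁ u₂ x : EuclideanSpace ℝ (Fin 3)) (h₁ : ‖u₁‖ = 1) (h₂ : ‖u₂‖ = 1)
    (h12 : ⟪u₁, u₂⟫_ℝ = 0) : ⟪u₁, x⟫_ℝ ^ 2 + ⟪u₂, x⟫_ℝ ^ 2 ≤ ‖x‖ ^ 2 := by
  have h0 : 0 ≤ ‖x - ⟪u₁, x⟫_ℝ • u₁ - ⟪u₂, x⟫_ℝ • u₂‖ ^ 2 := sq_nonneg _
  have hexp : ‖x - ⟪u₁, x⟫_ℝ • u₁ - ⟪u₂, x⟫_ℝ • u₂‖ ^ 2 = ‖x‖ ^ 2 - ⟪u₁, x⟫_ℝ ^ 2 - ⟪u₂, x⟫_ℝ ^ 2 := by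
    have n1 : ⟪u₁, u₁⟫_ℝ = 1 := by rw [real_inner_self_eq_norm_sq, h₁, one_pow]
    have n2 : ⟪u₂, u₂⟫_ℝ = 1 := by rw [real_inner_self_eq_norm_sq, h₂, one_pow]
    have h21 : ⟪u₂, u₁⟫_ℝ = 0 := by rw [real_inner_comm]; exact h12
    rw [← real_inner_self_eq_norm_sq, ← real_inner_self_eq_norm_sq]
    simp only [inner_sub_left, inner_sub_right, inner_smul_left, inner_smul_right, n1, n2, h12, h21,
      real_inner_comm x u₁, real_inner_comm x u₂, RCLike.conj_to_real]
    ring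
  linarith

/-- **Half the norm off an antipodal pair.**  For every slot `r` and every `x` there is a slot `w ≠ ±r` with
`‖x‖² ≤ 4 ⟪A w, x⟫²` and `⟪A w, x⟫ ≥ 0`. -/
theorem exists_slot_inner_ge_half_avoiding (A : EuclideanSpace ℝ (Fin 3) ≃ₗᵢ[ℝ] EuclideanSpace ℝ (Fin 3))
    {r : EuclideanSpace ℝ (Fin 3)} (hr : r ∈ fccSlots) (x : EuclideanSpace ℝ (Fin 3)) :
    ∃ w ∈ fccSlots, w ≠ r ∧ w ≠ -r ∧ ‖x‖ ^ 2 ≤ 4 * ⟪A w, x⟫_ℝ ^ 2 ∧ 0 ≤ ⟪A w, x⟫_ℝ := by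
  classical
  obtain ⟨r', hr', hrr'⟩ := exists_perp_slot hr
  have hr1 : ‖r‖ = 1 := norm_eq_one_of_mem_fccSlots hr
  have hr'1 : ‖r'‖ = 1 := norm_eq_one_of_mem_fccSlots hr'
  have rr : ⟪r, r⟫_ℝ = 1 := by rw [real_inner_self_eq_norm_sq, hr1, one_pow]
  have r'r' : ⟪r', r'⟫_ℝ = 1 := by rw [real_inner_self_eq_norm_sq, hr'1, one_pow]
  -- the four removed slots are pairwise distinct
  have hne1 : -r ≠ r := by
    intro h; have : ⟪-r, r⟫_ℝ = ⟪r, r⟫_ℝ := by rw [h]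
    rw [inner_neg_left, rr] at this; norm_num at this
  have hne2 : r' ≠ r := by intro h; rw [h, rr] at hrr'; norm_num at hrr'
  have hne3 : r' ≠ -r := by intro h; rw [h, inner_neg_right, rr] at hrr'; norm_num at hrr'
  have hne4 : -r' ≠ r := by
    intro h; have : ⟪r, -r'⟫_ℝ = ⟪r, r⟫_ℝ := by rw [h]
    rw [inner_neg_right, hrr', rr] at this; norm_num at this
  have hne5 : -r' ≠ -r := by intro h; exact hne2 (neg_injective h)
  have hne6 : -r' ≠ r' := by
    intro h; have : ⟪-r', r'⟫_ℝ = ⟪r', r'⟫_ℝ := by rw [h]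
    rw [inner_neg_left, r'r'] at this; norm_num at this
  -- the eight-slot set
  set S := (((fccSlots.erase r).erase (-r)).erase r').erase (-r') with hS
  have hmr : -r ∈ fccSlots.erase r := mem_erase.2 ⟨hne1, neg_mem_fccSlots hr⟩
  have hmr' : r' ∈ (fccSlots.erase r).erase (-r) := mem_erase.2 ⟨hne3, mem_erase.2 ⟨hne2, hr'⟩⟩
  have hmnr' : -r' ∈ ((fccSlots.erase r).erase (-r)).erase r' :=
    mem_erase.2 ⟨hne6, mem_erase.2 ⟨hne5, mem_erase.2 ⟨hne4, neg_mem_fccSlots hr'⟩⟩⟩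
  have hcard : S.card = 8 := by
    rw [hS, card_erase_of_mem hmnr', card_erase_of_mem hmr', card_erase_of_mem hmr, card_erase_of_mem hr, card_fccSlots]
  have hsum : ∑ w ∈ S, ⟪A w, x⟫_ℝ ^ 2 =
      4 * ‖x‖ ^ 2 - ⟪A r, x⟫_ℝ ^ 2 - ⟪A (-r), x⟫_ℝ ^ 2 - ⟪A r', x⟫_ℝ ^ 2 - ⟪A (-r'), x⟫_ℝ ^ 2 := by
    rw [hS, sum_erase_eq_sub hmnr', sum_erase_eq_sub hmr', sum_erase_eq_sub hmr, sum_erase_eq_sub hr,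
      sum_slots_inner_sq_frame]
  have hAr : ‖A r‖ = 1 := by rw [LinearIsometryEquiv.norm_map, hr1]
  have hAr' : ‖A r'‖ = 1 := by rw [LinearIsometryEquiv.norm_map, hr'1]
  have hArr' : ⟪A r, A r'⟫_ℝ = 0 := by rw [LinearIsometryEquiv.inner_map_map]; exact hrr'
  have hB := bessel_two_local (A r) (A r') x hAr hAr' hArr'
  have hneg1 : ⟪A (-r), x⟫_ℝ ^ 2 = ⟪A r, x⟫_ℝ ^ 2 := by rw [map_neg, inner_neg_left]; ring
  have hneg2 : ⟪A (-r'), x⟫_ℝ ^ 2 = ⟪A r', x⟫_ℝ ^ 2 := by rw [map_neg, inner_neg_left]; ring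
  have hc : 2 * ‖x‖ ^ 2 ≤ ∑ w ∈ S, ⟪A w, x⟫_ℝ ^ 2 := by rw [hsum, hneg1, hneg2]; linarith
  have hSneg : ∀ w ∈ S, -w ∈ S := by
    intro w hw
    simp only [hS, mem_erase] at hw ⊢
    obtain ⟨h1, h2, h3, h4, h5⟩ := hw
    exact ⟨fun h => h2 (neg_injective h), fun h => h1 (by rw [← neg_neg w, h]), fun h => h4 (neg_injective h),
      fun h => h3 (by rw [← neg_neg w, h]), neg_mem_fccSlots h5⟩
  have hSne : S.Nonempty := by rw [← card_pos, hcard]; norm_num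
  obtain ⟨w, hw, hle, hsgn⟩ := exists_slot_inner_sq_ge_of_sum A S hSneg hSne x hc
  rw [hcard] at hle; push_cast at hle
  simp only [hS, mem_erase] at hw
  obtain ⟨-, -, h2, h1, hwS⟩ := hw
  exact ⟨w, hwS, h1, h2, by linarith, hsgn⟩

/-- **A hole whose cage misses only an antipodal pair is addable.**  If `X` is a unit packing, `v ∉ X`, `r` a slot, and the
ten cage sites `v + A w` (`w ≠ ±r`) are balls of `X`, then every ball of `X` is at distance `≥ 1` from `v`. -/
theorem one_le_dist_of_cage_sub_pair (hX : ∀ p ∈ X, ∀ q ∈ X, p ≠ q → 1 ≤ dist p q)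
    (A : EuclideanSpace ℝ (Fin 3) ≃ₗᵢ[ℝ] EuclideanSpace ℝ (Fin 3)) {v : EuclideanSpace ℝ (Fin 3)} (hv : v ∉ X)
    {r : EuclideanSpace ℝ (Fin 3)} (hr : r ∈ fccSlots) (hcage : ∀ w ∈ fccSlots, w ≠ r → w ≠ -r → v + A w ∈ X) :
    ∀ x ∈ X, 1 ≤ dist x v := by
  intro x hx
  by_contra hlt
  rw [not_le] at hlt
  have hxv : x ≠ v := fun h => hv (h ▸ hx)
  have hpos : 0 < ‖x - v‖ := norm_pos_iff.2 (sub_ne_zero.2 hxv)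
  have hlt' : ‖x - v‖ < 1 := by rwa [dist_eq_norm] at hlt
  obtain ⟨w, hw, hwr, hwnr, hsq, hsgn⟩ := exists_slot_inner_ge_half_avoiding A hr (x - v)
  have hAw : ‖A w‖ = 1 := by rw [LinearIsometryEquiv.norm_map, norm_eq_one_of_mem_fccSlots hw]
  have hinner : ‖x - v‖ ^ 2 < 2 * ⟪A w, x - v⟫_ℝ := by
    by_contra hle
    rw [not_lt] at hle
    have hn2 : ‖x - v‖ ^ 2 < ‖x - v‖ := by nlinarith
    have ht : ⟪A w, x - v⟫_ℝ < ‖x - v‖ / 2 := by linarith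
    have ht2 : ⟪A w, x - v⟫_ℝ ^ 2 < (‖x - v‖ / 2) ^ 2 := by
      have := mul_self_lt_mul_self hsgn ht
      nlinarith [this]
    nlinarith [hsq, ht2, hpos]
  have hd : dist x (v + A w) ^ 2 < 1 := by
    rw [dist_sq_cage_site x v (A w) hAw]; linarith
  have hd1 : dist x (v + A w) < 1 := by
    have h0 : 0 ≤ dist x (v + A w) := dist_nonneg
    nlinarith
  have hne : x ≠ v + A w := by
    intro h
    rw [h, dist_eq_norm, add_sub_cancel_left, hAw] at hlt
    exact lt_irrefl _ hlt
  exact absurd (hX x hx (v + A w) (hcage w hw hwr hwnr) hne) (not_le.2 hd1)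

/-- **Every ball touching a row-vacancy hole has at most eleven contacts.** -/
theorem card_contacts_le_eleven_of_cage_sub_pair (hX : ∀ p ∈ X, ∀ q ∈ X, p ≠ q → 1 ≤ dist p q)
    (A : EuclideanSpace ℝ (Fin 3) ≃ₗᵢ[ℝ] EuclideanSpace ℝ (Fin 3)) {v : EuclideanSpace ℝ (Fin 3)} (hv : v ∉ X)
    {r : EuclideanSpace ℝ (Fin 3)} (hr : r ∈ fccSlots) (hcage : ∀ w ∈ fccSlots, w ≠ r → w ≠ -r → v + A w ∈ X)
    {y : EuclideanSpace ℝ (Fin 3)} (hyv : dist y v = 1) : (X.filter fun q => dist y q = 1).card ≤ 11 :=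
  card_contacts_le_eleven_of_addable X hX v
    (fun q hq => by rw [dist_comm]; exact one_le_dist_of_cage_sub_pair hX A hv hr hcage q hq) hyv

end Summit.Ventures.Crystal3D.Theorems

end
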